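import Summits.Schanuel.Schanuel.Theorems.DiophantineDichotomyKhovanskiiApproxTypeEvRareFieldLWDh
import Summits.Schanuel.Schanuel.Theorems.EPiSimultaneousType.Negative.CoordinatewiseLinear
import Summits.Schanuel.Schanuel.Theorems.DiophantineDichotomyKhovanskiiApproxTypeEvMinimalClause
import Summits.Schanuel.Schanuel.Theorems.DiophantineDichotomyKhovanskiiApproxTypeEvExpAlgClauseMeasure
import HarnessLib

/-!
# The naive Lindemann–Weierstrass layer holds with the certificate-game value `a = (n+1)/(2n)`
# at every rank (`stub_evLWGameValue`)

Line `Sketch` of crux `DiophantineDichotomy.KhovanskiiApproxTypeEv` (stmt-Schanuel-14972), skeleton v10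
(lead `prover-line-stmt-Schanuel-14972-c12-0`), registered stub `stub_evLWGameValue` — `--supports`.

Leaf B of the crux (`stub_evLW_rankThreeUp : ∀ n ≥ 3, EvLW n`) asks, at every Lindemann–Weierstrass point
`s ∈ ℚ̄ⁿ` with `ℚ`-linearly independent coordinates, for an eventual approximation type `a < 1/(n−1)`
(`ApproxTypeEvAt n s a b C`).  Line `rare-field-species` proved that the sub-tuple certificate game of every
`(degree, absolute height)`-priced architecture has value exactly `(n+1)/(2n)` (the equalising profile makes every
sub-tuple certificate cost that much, `certificate_value`; the singleton and full-tuple certificates already achieve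
it, `two_certificate_cap`; p136514) and that in `(d,h)` currency the layer is a theorem at every rank (`evLWDh`,
p137028, exponent `1 + 1/n` divided by the minimal `y`-degree `m`); in naive currency the tree had only `a = 1 + 1/n` on all challengers (`approxTypeEvAt_lw_naive`)
and `a = 1 + 1/n − x` on balanced ones (`evLWBalanced`).  This file proves that the game value IS ATTAINED on ALL
challengers, unconditionally:

  `stub_evLWGameValue : ∀ n ≥ 1, ∀ s ∈ ℚ̄ⁿ lin. indep., ∃ C, ApproxTypeEvAt n s ((n+1)/(2n)) 2 C`.

Proof (the two certificates of `two_certificate_cap`, run as theorems): for a challenger `γ` of level `(d, H)` let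
`m := min_j deg_ℚ γ_{y,j}`, attained at `j₀`.  FULL-TUPLE certificate: `evLWDh` at rank `n` gives
`‖γ − θ‖ ≥ exp(−C_F d^{1+1/n} log H / m)`.  SINGLE-SLOT certificate at `j₀`: the clause of `γ_{y,j₀}` is replaced by
an irreducible one of degree `m` and height `≤ 2^d (d+1) H` (`stub_minimalClause`), and the degree-linear
one-variable measure at `e^{s_{j₀}}` (`stub_expAlgIrredClauseMeasure`, Mahler 1932 / Ably 1994 at `m = 1` through
`evLWDh` at rank 1) gives `‖γ − θ‖ ≥ |γ_{y,j₀} − e^{s_{j₀}}| ≥ exp(−C_S m (log H + 2d))`.  With `a := (n+1)/(2n)`,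
`1 + 1/n = 2a`: if `m ≥ dᵃ` the first exponent is `≤ C_F dᵃ log H`; otherwise the second is
`≤ C_S (dᵃ log H + 2d²)`.  So `ApproxTypeEvAt n s a 2 (2(C_S + C_F))`.  At `n = 2` this re-proves `a = 3/4`
(`approxTypeEvAt_lw_two_threeQuarters`; the landed `stub_evLW_two`, p123471, went another route); at `n = 3` it gives
`a = 2/3` (`approxTypeEvAt_lw_three_twoThirds`), the state of
the art of leaf B in the crux's own vocabulary, against the demand `a < 1/2`.  Everything here is proved; no named
facts.
-/

noncomputable section

set_option linter.dupNamespace false -- mandated summit/sub-problem namespace (single-conjunct summit)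

namespace Summit.Schanuel.Schanuel.Cruxes.KhovanskiiApproxTypeEv.AnchoredReduction

open Summit.Schanuel.Schanuel.Cruxes.KhovanskiiApproxTypeEv.RareFieldSpecies (evLWDh)
open Summit.Schanuel.Schanuel.Cruxes.KhovanskiiApproxType.HeightWindowCompactness (one_le_of_clause)
open Summit.Schanuel.Schanuel.Theorems.EPiSimultaneousType (finrank_adjoin_simple_le_of_clause)
open Polynomial

/-- The degree of an integer polynomial that is irreducible over `ℚ` and vanishes at `z` is the degree of `z`
over `ℚ`. [folklore] -/
theorem gameValue_natDegree_eq_minpoly {z : ℂ} {R : Polynomial ℤ}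
    (hirr : Irreducible (R.map (Int.castRingHom ℚ))) (hz : Polynomial.aeval z R = 0) :
    R.natDegree = (minpoly ℚ z).natDegree := by
  set p : ℚ[X] := R.map (Int.castRingHom ℚ) with hp
  have hp' : p = R.map (algebraMap ℤ ℚ) := by rw [hp, algebraMap_int_eq]
  have hroot : Polynomial.aeval z p = 0 := by rw [hp', Polynomial.aeval_map_algebraMap]; exact hz
  have hmin := minpoly.eq_of_irreducible hirr hroot
  have hlc : p.leadingCoeff⁻¹ ≠ 0 := inv_ne_zero (leadingCoeff_ne_zero.2 hirr.ne_zero)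
  have h1 : (minpoly ℚ z).natDegree = p.natDegree := by
    rw [← hmin, natDegree_mul_C hlc]
  rw [h1, hp, natDegree_map_eq_of_injective (Int.castRingHom ℚ).injective_int]

/-- Logarithm bookkeeping for the irreducible clause height `2^d (d+1) H`:
`log (2^d (d+1) H) ≤ log H + 2d` for `d ≥ 1`, `H ≥ 1`. [folklore] -/
theorem log_irredHeight_le {d H : ℕ} (hd : 1 ≤ d) (hH : 1 ≤ H) :
    Real.log ((2 ^ d * (d + 1) * H : ℕ) : ℝ) ≤ Real.log H + 2 * d := by
  have hd0 : (0 : ℝ) < d := by exact_mod_cast hd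
  have hH0 : (0 : ℝ) < H := by exact_mod_cast hH
  have h2d : (0 : ℝ) < (2 : ℝ) ^ d := by positivity
  have hd1 : (0 : ℝ) < (d : ℝ) + 1 := by positivity
  push_cast
  rw [Real.log_mul (by positivity) hH0.ne', Real.log_mul h2d.ne' hd1.ne', Real.log_pow]
  have hlog2 : Real.log 2 ≤ 1 := by
    have := Real.log_two_lt_d9
    linarith
  have hlogd : Real.log ((d : ℝ) + 1) ≤ d := by
    have := Real.add_one_le_exp (d : ℝ)
    calc Real.log ((d : ℝ) + 1) ≤ Real.log (Real.exp d) :=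
          Real.log_le_log hd1 this
      _ = d := Real.log_exp _
  nlinarith [Real.log_nonneg (by norm_num : (1 : ℝ) ≤ 2)]

/-- **`stub_evLWGameValue` — THE NAIVE LW LAYER WITH THE GAME VALUE `a = (n+1)/(2n)`, EVERY RANK** (registered
sub-goal of line `Sketch`, skeleton v10; lead c12): at every `s ∈ ℚ̄ⁿ` (`n ≥ 1`) with `ℚ`-linearly independent
coordinates, `ApproxTypeEvAt n s ((n+1)/(2n)) 2 C` for some `C` — single-slot certificate (Mahler/Ably at `m = 1`,
degree-linear, on the irreducible clause of the `y`-coordinate of least degree `m`) if `m < dᵃ`, full-tuple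
certificate (`evLWDh`, exponent `1 + 1/n = 2a` divided by `m`) if `m ≥ dᵃ` — the two certificates of
`two_certificate_cap` (p136514) run as theorems; by `certificate_value` (p136514) no `(degree, absolute height)`-priced
sub-tuple certificate does better against the equalising profile.  Leaf B of the crux demands
`a < 1/(n−1) < (n+1)/(2n)` (`n ≥ 3`). [cite: Ably1994, Théorème p. 30] -/
theorem stub_evLWGameValue (n : ℕ) (s : Fin n → ℂ) (hn : 1 ≤ n) (halg : ∀ i, IsAlgebraic ℚ (s i))
    (hli : LinearIndependent ℚ s) :
    ∃ C : ℝ, ApproxTypeEvAt n s (((n : ℝ) + 1) / (2 * n)) 2 C := by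
  -- the two certificate engines
  obtain ⟨CF, hCF, hallF⟩ := evLWDh n s hn halg hli
  choose CS hCS hallS using
    fun j : Fin n => stub_expAlgIrredClauseMeasure (s j) (halg j) (hli.ne_zero j)
  set C₁ : ℝ := ∑ j, CS j with hC₁
  have hC₁j : ∀ j, CS j ≤ C₁ := fun j =>
    Finset.single_le_sum (f := CS) (fun i _ => (hCS i).le) (Finset.mem_univ j)
  have hC₁0 : 0 ≤ C₁ := Finset.sum_nonneg fun i _ => (hCS i).le
  -- the exponent
  set a : ℝ := ((n : ℝ) + 1) / (2 * n) with ha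
  have hn0 : (0 : ℝ) < n := by exact_mod_cast hn
  have hn1 : (1 : ℝ) ≤ n := by exact_mod_cast hn
  have ha0 : 0 < a := by rw [ha]; positivity
  have ha1 : a ≤ 1 := by
    rw [ha, div_le_one (by positivity)]
    linarith
  have hpa : 1 + 1 / (n : ℝ) = a + a := by
    rw [ha]; field_simp; ring
  refine ⟨2 * (C₁ + CF), by positivity, fun d => ?_⟩
  obtain ⟨HF, hHF⟩ := hallF d
  choose HS hHS using fun j : Fin n => hallS j d
  refine ⟨max HF (max (Finset.univ.sup HS) 2), fun H γ hH hfr hpoly => ?_⟩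
  have hHF' : HF ≤ H := le_trans (le_max_left _ _) hH
  have hHS' : ∀ j, HS j ≤ H := fun j =>
    le_trans (le_trans (Finset.le_sup (Finset.mem_univ j)) (le_max_left _ _))
      (le_trans (le_max_right _ _) hH)
  have hH2 : 2 ≤ H := le_trans (le_trans (le_max_right _ _) (le_max_right _ _)) hH
  have hH1 : 1 ≤ H := le_trans (by norm_num) hH2
  have hH1r : (1 : ℝ) < H := by exact_mod_cast hH2
  have hlogH : 0 ≤ Real.log H := Real.log_nonneg hH1r.le
  -- the minimising `y`-coordinate and its degree `m`, `1 ≤ m ≤ d`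
  obtain ⟨j₀, -, hmin⟩ := Finset.exists_min_image Finset.univ
    (fun j : Fin n => (minpoly ℚ (γ (Sum.inr j))).natDegree) ⟨⟨0, hn⟩, Finset.mem_univ _⟩
  obtain ⟨hint, hfr₀⟩ := finrank_adjoin_simple_le_of_clause (hpoly (Sum.inr j₀))
  set m : ℕ := (minpoly ℚ (γ (Sum.inr j₀))).natDegree with hm
  have hm1 : 1 ≤ m := minpoly.natDegree_pos hint
  have hmd : m ≤ d := by
    rw [hm, ← IntermediateField.adjoin.finrank hint]
    exact hfr₀
  have hd1 : 1 ≤ d := hm1.trans hmd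
  have hd0 : (0 : ℝ) < d := by exact_mod_cast hd1
  have hd1r : (1 : ℝ) ≤ d := by exact_mod_cast hd1
  have hm0 : (0 : ℝ) < m := by exact_mod_cast hm1
  -- sup-norm bookkeeping at the slot `j₀`
  set z : ℂ := γ (Sum.inr j₀) with hz
  have hcoord : ‖z - Complex.exp (s j₀)‖ ≤ ‖γ - Sum.elim s (Complex.exp ∘ s)‖ := by
    have := norm_le_pi_norm (γ - Sum.elim s (Complex.exp ∘ s)) (Sum.inr j₀)
    simpa [hz] using this
  -- FULL-TUPLE certificate
  have hfull : Real.exp (-(CF * (d : ℝ) ^ (1 + 1 / (n : ℝ)) * Real.log H / m)) ≤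
      ‖γ - Sum.elim s (Complex.exp ∘ s)‖ :=
    hHF H m γ hHF' hm1 hmd hfr hpoly fun j => hmin j (Finset.mem_univ j)
  -- SINGLE-SLOT certificate at `j₀`: irreducible clause of degree `m`, height `≤ 2^d (d+1) H`
  obtain ⟨P, hP0, hPdeg, hPH, hProot⟩ := hpoly (Sum.inr j₀)
  obtain ⟨R, hirr, hRroot, -, hRdeg, hRcoef⟩ := stub_minimalClause z d H P hP0 hPdeg hPH hProot
  have hRm : R.natDegree = m := by rw [hm, hz]; exact gameValue_natDegree_eq_minpoly hirr hRroot
  set H' : ℕ := 2 ^ d * (d + 1) * H with hH'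
  have hHH' : H ≤ H' := by
    have h1 : 1 ≤ 2 ^ d * (d + 1) := Nat.one_le_iff_ne_zero.2 (by positivity)
    calc H = 1 * H := (one_mul _).symm
      _ ≤ 2 ^ d * (d + 1) * H := Nat.mul_le_mul_right _ h1
  have hsingle : Real.exp (-(CS j₀ * (m : ℝ) * Real.log H')) ≤ ‖γ - Sum.elim s (Complex.exp ∘ s)‖ := by
    have h := hHS j₀ H' z R ((hHS' j₀).trans hHH') hirr hRroot hRdeg (fun l => by
      simpa [hH'] using hRcoef l)
    rw [hRm] at h
    exact h.trans hcoord
  have hlogH' : Real.log H' ≤ Real.log H + 2 * d := log_irredHeight_le hd1 hH1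
  have hlogH'0 : 0 ≤ Real.log H' :=
    Real.log_nonneg (by exact_mod_cast hH1.trans hHH')
  -- the two cases of the certificate game
  have hda0 : 0 < (d : ℝ) ^ a := Real.rpow_pos_of_pos hd0 _
  have hda1 : 1 ≤ (d : ℝ) ^ a := Real.one_le_rpow hd1r ha0.le
  have hdad : (d : ℝ) ^ a ≤ d := by
    calc (d : ℝ) ^ a ≤ (d : ℝ) ^ (1 : ℝ) := Real.rpow_le_rpow_of_exponent_le hd1r ha1
      _ = d := Real.rpow_one _
  have hd2 : (d : ℝ) ^ (2 : ℝ) = (d : ℝ) * d := by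
    rw [show (2 : ℝ) = ((2 : ℕ) : ℝ) by norm_num, Real.rpow_natCast, sq]
  by_cases hcase : (m : ℝ) ≤ (d : ℝ) ^ a
  · -- single slot: `CS m log H' ≤ C₁ dᵃ (log H + 2d) ≤ 2 (C₁ + CF) (dᵃ log H + d²)`
    refine le_trans (Real.exp_le_exp.2 (neg_le_neg ?_)) hsingle
    have h1 : CS j₀ * (m : ℝ) * Real.log H' ≤ C₁ * (d : ℝ) ^ a * (Real.log H + 2 * d) := by
      apply mul_le_mul (mul_le_mul (hC₁j j₀) hcase hm0.le hC₁0) hlogH' hlogH'0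
      positivity
    have h2 : (d : ℝ) ^ a * (2 * d) ≤ 2 * (d : ℝ) ^ (2 : ℝ) := by
      rw [hd2]; nlinarith [hdad, hd0]
    rw [hd2] at h2 ⊢
    nlinarith [h1, h2, hC₁0, hCF.le, hlogH, hda0, mul_nonneg hC₁0 (mul_nonneg hda0.le hlogH),
      mul_nonneg hCF.le (mul_nonneg hda0.le hlogH), mul_nonneg hC₁0 hd0.le]
  · -- full tuple: `CF d^{2a} log H / m ≤ CF dᵃ log H ≤ 2 (C₁ + CF) (dᵃ log H + d²)`
    push Not at hcase
    refine le_trans (Real.exp_le_exp.2 (neg_le_neg ?_)) hfull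
    have hsplit : (d : ℝ) ^ (1 + 1 / (n : ℝ)) = (d : ℝ) ^ a * (d : ℝ) ^ a := by
      rw [hpa, Real.rpow_add hd0]
    have h1 : CF * (d : ℝ) ^ (1 + 1 / (n : ℝ)) * Real.log H / m ≤ CF * (d : ℝ) ^ a * Real.log H := by
      rw [hsplit, div_le_iff₀ hm0]
      have : CF * ((d : ℝ) ^ a * (d : ℝ) ^ a) * Real.log H =
          (CF * (d : ℝ) ^ a * Real.log H) * (d : ℝ) ^ a := by ring
      rw [this]
      exact mul_le_mul_of_nonneg_left hcase.le (by positivity)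
    rw [hd2]
    nlinarith [h1, hC₁0, hCF.le, hlogH, hda0, mul_nonneg hC₁0 (mul_nonneg hda0.le hlogH),
      mul_nonneg hCF.le (mul_nonneg hda0.le hlogH), mul_nonneg hC₁0 hd0.le, mul_nonneg hCF.le hd0.le]

/-- **Rank 3: `a = 2/3` at every Lindemann–Weierstrass triple, unconditionally** — the state of the art of leaf B
(`EvLW 3` demands some `a < 1/2`) in the crux's own vocabulary `ApproxTypeEvAt`. [folklore] -/
theorem approxTypeEvAt_lw_three_twoThirds (s : Fin 3 → ℂ) (halg : ∀ i, IsAlgebraic ℚ (s i))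
    (hli : LinearIndependent ℚ s) : ∃ C : ℝ, ApproxTypeEvAt 3 s (2 / 3) 2 C := by
  obtain ⟨C, hC⟩ := stub_evLWGameValue 3 s (by norm_num) halg hli
  refine ⟨C, ?_⟩
  have h : (((3 : ℕ) : ℝ) + 1) / (2 * ((3 : ℕ) : ℝ)) = 2 / 3 := by norm_num
  rw [h] at hC
  exact hC

/-- **Rank 2: `a = 3/4` at every Lindemann–Weierstrass pair, through the game** — the exponent of the closed
rank-2 layer (`stub_evLW_two : EvLWTwo`, p123471, went through the slot dichotomy; `EvLWTwo` asks for some `a < 1`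
and follows from this at once — not restated here) by a second, shorter kernel route (both rest on Ably 1994 and the
relative-Siegel transfer). [folklore] -/
theorem approxTypeEvAt_lw_two_threeQuarters (s : Fin 2 → ℂ) (halg : ∀ i, IsAlgebraic ℚ (s i))
    (hli : LinearIndependent ℚ s) : ∃ C : ℝ, ApproxTypeEvAt 2 s (3 / 4) 2 C := by
  obtain ⟨C, hC⟩ := stub_evLWGameValue 2 s (by norm_num) halg hli
  refine ⟨C, ?_⟩
  have h : (((2 : ℕ) : ℝ) + 1) / (2 * ((2 : ℕ) : ℝ)) = 3 / 4 := by norm_num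
  rw [h] at hC
  exact hC

/-- The game value never reaches leaf B's threshold at rank `n ≥ 3`: `1/(n−1) < (n+1)/(2n)` (cf. `threshold_lt_cap`,
p136514) — so `stub_evLWGameValue` does not touch `EvLW n`, `n ≥ 3`; it only pins the proved side of its window.
[folklore] -/
theorem gameValue_above_threshold {n : ℕ} (hn : 3 ≤ n) :
    1 / ((n : ℝ) - 1) < ((n : ℝ) + 1) / (2 * n) := by
  have hn' : (3 : ℝ) ≤ n := by exact_mod_cast hn
  rw [div_lt_div_iff₀ (by linarith) (by positivity)]
  nlinarith

end Summit.Schanuel.Schanuel.Cruxes.KhovanskiiApproxTypeEv.AnchoredReduction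

end
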